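import Summits.CriticalPhenomena.PercolationContinuityZ3.Theorems.PercNearOneGluingNoHeavyLowerTailFirstReachedIsolation
import Summits.CriticalPhenomena.PercolationContinuityZ3.Theorems.PercNearOneGluingNoHeavyLowerTailSelectionPrinciple
import Summits.CriticalPhenomena.PercolationContinuityZ3.Theorems.PercNearOneGluingNoHeavyLowerTailBlockLightestTop
import Literature.Probability.Percolation.AnchoredIsoperimetricProfileProofs
import HarnessLib

/-!
# `NoHeavyLowerTail` (stmt-CriticalPhenomena-4575) — the PL-block and PL bounds (registered stubs `stub_blockLightest`,
# `stub_patternLightest` of prim-hp-8) at LEVEL `j = 1` are theorems for every relay set; PL-block for `|A| ≤ 3`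

Hull-port prover #4 (prim-hp-4 gen 7, LP-duality line), 2026-08-19.  `μ = prodBernoulli w` on `Fin n`, relays `A`, observer `o`,
`π(v) = A.filter (v ↔ ·)` (relay block), `π⁰(o) = A.filter (b ↦ o ↔ b inside (↑A)ᶜ ∪ {b})` (directly attached relays), `N = |π(o)|`.
prim-hp-8's pattern-lightest bounds (`…PatternLightest.lean`: PL ⇒ PL-block-free CIL ⇒ crux) ask for a selection `sel B ∈ B` with
`μ(1 ≤ N ≤ j) ≤ Σ_{∅≠B⊆A} μ(pattern = B)·μ(|π(sel B)| ≤ j)` for the pattern `π(o)` (PL-block) resp. `π⁰(o)` (PL).  **At `j = 1` both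
hold for every `A`** (`blockLightest_levelOne`, `patternLightest_levelOne`), with `sel B` = the relay of `B` of largest isolation
probability `q_c = μ(|π(c)| ≤ 1) = μ(c ↮ A∖c)`:  `μ(N = 1) ≤ E[max_{c ∈ π⁰(o)} q_c ; o ↔ A] ≤ E[max_{c ∈ π(o)} q_c ; o ↔ A]`.
Mechanism (`firstReached_isolation_le_events`, file `…FirstReachedIsolation.lean`): condition on total separation `M` of the relays
(block terminal separation transfers `Σ_c μ(π(o)={c})` to `M`); on `M` the vertex `o` meets one relay, which is then directly attached,
so the selection is forced; `q_W·1{W defined}` is increasing for the ranking by decreasing `q`; Harris against the decreasing `M`.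
With `blockLightest_top` (levels `j ≥ |A|−1`, Harris): PL-block is a theorem for `|A| ≤ 3` at every level (`blockLightest_card_le_three`).
No definitions, no sorries, standard axioms.
-/

noncomputable section

namespace Summit.CriticalPhenomena.PercolationContinuityZ3.Theorems

open MeasureTheory Set Literature.Probability.LatticeModels Literature.Probability.Percolation
open scoped Classical BigOperators

namespace SelectionOrder

variable {n : ℕ}

/-- **PL-block at level `j = 1`, for every relay set** (the `j = 1` instance of the registered stub `stub_blockLightest`,
shape, and even without `o ∉ A`): there is a selection `sel B ∈ B` (the relay of `B` of largest isolation probability) with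
`μ(1 ≤ N ≤ 1) ≤ Σ_{∅≠B⊆A} μ(π(o) = B)·μ(|π(sel B)| ≤ 1)`, i.e. `μ(N = 1) ≤ E[max_{c∈π(o)} μ(c ↮ A∖c); π(o) ≠ ∅]`.
[cite: KozmaNitzan2024, Lemma 1(i), Lemma 2 (pp. 5–6); this work] -/
theorem blockLightest_levelOne (w : Sym2 (Fin n) → unitInterval) (A : Finset (Fin n)) (o : Fin n) :
    ∃ sel : Finset (Fin n) → Fin n, (∀ B ∈ A.powerset.erase ∅, sel B ∈ B) ∧
      (prodBernoulli w).real {ω : BondConfig (Fin n) |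
          1 ≤ (A.filter fun x => ω ∈ openConn o x).card ∧ (A.filter fun x => ω ∈ openConn o x).card ≤ 1} ≤
        ∑ B ∈ A.powerset.erase ∅,
          (prodBernoulli w).real {ω : BondConfig (Fin n) | (A.filter fun x => ω ∈ openConn o x) = B} *
            (prodBernoulli w).real
              {ω : BondConfig (Fin n) | (A.filter fun x => ω ∈ openConn (sel B) x).card ≤ 1} := by
  set μ := prodBernoulli w with hμ
  set D : Fin n → Set (BondConfig (Fin n)) := fun b => {ω | ∀ a ∈ A \ {b}, ω ∉ openConn b a} with hD
  set q : Fin n → ℝ := fun b => μ.real (D b) with hqdef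
  -- rank by decreasing isolation probability and select the first relay of each block
  obtain ⟨ρ, hρ, hmono⟩ := CoinReduction.exists_compatible_ranking q A
  set sel : Finset (Fin n) → Fin n := fun B =>
    if h : B.Nonempty then Classical.choose (Finset.exists_min_image B ρ h) else o with hseldef
  have hsel : ∀ B : Finset (Fin n), B.Nonempty → sel B ∈ B ∧ ∀ b ∈ B, ρ (sel B) ≤ ρ b := by
    intro B hB
    have hspec := Classical.choose_spec (Finset.exists_min_image B ρ hB)
    simp only [hseldef, dif_pos hB]
    exact ⟨hspec.1, hspec.2⟩
  have hselmem : ∀ B ∈ A.powerset.erase ∅, sel B ∈ B := fun B hB =>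
    (hsel B (Finset.nonempty_iff_ne_empty.2 (Finset.ne_of_mem_erase hB))).1
  refine ⟨sel, hselmem, ?_⟩
  -- (1) `{N = 1}` is covered by the events `{o ↔ c} ∩ {c ↮ A∖c}`
  have hcover : {ω : BondConfig (Fin n) |
        1 ≤ (A.filter fun x => ω ∈ openConn o x).card ∧ (A.filter fun x => ω ∈ openConn o x).card ≤ 1} ⊆
      ⋃ c ∈ A, (openConn o c ∩ D c) := by
    intro ω hω
    obtain ⟨h1, h2⟩ := hω
    have hcard : (A.filter fun x => ω ∈ openConn o x).card = 1 := le_antisymm h2 h1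
    obtain ⟨c, hc⟩ := Finset.card_eq_one.1 hcard
    have hcf : c ∈ A.filter fun x => ω ∈ openConn o x := by rw [hc]; exact Finset.mem_singleton_self c
    obtain ⟨hcA, hoc⟩ := Finset.mem_filter.1 hcf
    refine mem_iUnion₂.2 ⟨c, hcA, hoc, fun a ha hca => ?_⟩
    obtain ⟨haA, hac⟩ := Finset.mem_sdiff.1 ha
    have hoa : ω ∈ openConn o a := (hoc : (openGraph ω).Reachable o c).trans hca
    have : a ∈ A.filter fun x => ω ∈ openConn o x := Finset.mem_filter.2 ⟨haA, hoa⟩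
    rw [hc] at this
    exact hac this
  have hstep1 : μ.real {ω : BondConfig (Fin n) |
        1 ≤ (A.filter fun x => ω ∈ openConn o x).card ∧ (A.filter fun x => ω ∈ openConn o x).card ≤ 1} ≤
      ∑ c ∈ A, μ.real (openConn o c ∩ D c) :=
    (measureReal_mono hcover (measure_ne_top μ _)).trans (measureReal_biUnion_finset_le _ _)
  -- (2) the first-reached isolation bound with `S = A`
  have hstep2 := firstReached_isolation_le_events w A A o (subset_refl A) (fun c => openConn o c)
    (fun c _ => isUpperSet_openConn o c) (fun c _ => subset_refl _) (fun c _ ω h _ => h) ρ hρ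
    (fun b hb c hc h => hmono c hc b hb h)
  -- (3) selection sum = block sum, and lightness at level 1 = isolation
  have hstep3 := sum_first_eq_sum_blocks μ A o ρ hρ sel hsel q
  have hstep4 : ∑ B ∈ A.powerset.erase ∅, μ.real {ω : BondConfig (Fin n) | (A.filter fun x => ω ∈ openConn o x) = B} *
        q (sel B) =
      ∑ B ∈ A.powerset.erase ∅, μ.real {ω : BondConfig (Fin n) | (A.filter fun x => ω ∈ openConn o x) = B} *
        μ.real {ω : BondConfig (Fin n) | (A.filter fun x => ω ∈ openConn (sel B) x).card ≤ 1} := by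
    refine Finset.sum_congr rfl fun B hB => ?_
    have hBA : B ⊆ A := Finset.mem_powerset.1 (Finset.mem_of_mem_erase hB)
    rw [light_one_eq_isolated A (sel B) (hBA (hselmem B hB))]
  calc μ.real {ω : BondConfig (Fin n) |
          1 ≤ (A.filter fun x => ω ∈ openConn o x).card ∧ (A.filter fun x => ω ∈ openConn o x).card ≤ 1}
      ≤ ∑ c ∈ A, μ.real (openConn o c ∩ D c) := hstep1
    _ ≤ ∑ b ∈ A, μ.real (openConn o b ∩ {ω : BondConfig (Fin n) | ∀ c ∈ A, ρ c < ρ b → ω ∉ openConn o c}) * q b :=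
        hstep2
    _ = _ := hstep3
    _ = _ := hstep4


/-- **PL-block is a theorem for `|A| ≤ 3`, at every level**: level `0` is empty, level `1` is `blockLightest_levelOne`,
levels `j ≥ 2 ≥ |A| − 1` are `blockLightest_top` (Harris) — with one and the same selection (most isolated relay first).
[this work] -/
theorem blockLightest_card_le_three (w : Sym2 (Fin n) → unitInterval) (A : Finset (Fin n)) (o : Fin n) (j : ℕ)
    (h3 : A.card ≤ 3) :
    ∃ sel : Finset (Fin n) → Fin n, (∀ B ∈ A.powerset.erase ∅, sel B ∈ B) ∧
      (prodBernoulli w).real {ω : BondConfig (Fin n) |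
          1 ≤ (A.filter fun x => ω ∈ openConn o x).card ∧ (A.filter fun x => ω ∈ openConn o x).card ≤ j} ≤
        ∑ B ∈ A.powerset.erase ∅,
          (prodBernoulli w).real {ω : BondConfig (Fin n) | (A.filter fun x => ω ∈ openConn o x) = B} *
            (prodBernoulli w).real
              {ω : BondConfig (Fin n) | (A.filter fun x => ω ∈ openConn (sel B) x).card ≤ j} := by
  obtain ⟨sel, hsel, h1⟩ := blockLightest_levelOne w A o
  refine ⟨sel, hsel, ?_⟩
  by_cases hj0 : j = 0
  · subst hj0
    have h0 : {ω : BondConfig (Fin n) |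
        1 ≤ (A.filter fun x => ω ∈ openConn o x).card ∧ (A.filter fun x => ω ∈ openConn o x).card ≤ 0} = ∅ :=
      Set.subset_empty_iff.1 fun ω hω => by simp only [mem_setOf_eq] at hω; omega
    rw [h0, measureReal_empty]
    exact Finset.sum_nonneg fun B _ => mul_nonneg measureReal_nonneg measureReal_nonneg
  by_cases hj1 : j = 1
  · subst hj1; exact h1
  · exact blockLightest_top w A o j (by omega) sel hsel


/-- On `{o ↔ c} ∩ {c ↮ A ∖ c}` the relay `c` is DIRECTLY attached: `o ↔ c` inside `(↑A)ᶜ ∪ {c}` (every vertex of an open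
`o–c` walk lies in `C(o) = C(c)`, which meets `A` only in `c`). [folklore] -/
theorem openConnIn_of_openConn_of_isolated (A : Finset (Fin n)) (o c : Fin n) (ω : BondConfig (Fin n))
    (hoc : ω ∈ openConn o c) (hiso : ∀ a ∈ A \ {c}, ω ∉ openConn c a) :
    ω ∈ openConnIn ((↑A : Set (Fin n))ᶜ ∪ {c}) o c := by
  obtain ⟨p⟩ := (hoc : (openGraph ω).Reachable o c)
  refine mem_openConnIn_of_openWalk p fun z hz => ?_
  by_cases hzA : z ∈ A
  · right
    rw [Set.mem_singleton_iff]
    by_contra hzc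
    have hoz : (openGraph ω).Reachable o z := ⟨p.takeUntil z hz⟩
    have hcz : (openGraph ω).Reachable c z := p.reachable.symm.trans hoz
    exact hiso z (Finset.mem_sdiff.2 ⟨hzA, by rwa [Finset.mem_singleton]⟩) hcz
  · left
    exact fun h => hzA (Finset.mem_coe.1 h)

/-- **PL at level `j = 1`, for every relay set** (the `j = 1` instance of the registered stub `stub_patternLightest`, verbatim
shape, and even without `o ∉ A`): there is a selection `sel B ∈ B` (the relay of largest isolation probability) with
`μ(1 ≤ N ≤ 1) ≤ Σ_{∅≠B⊆A} μ(π⁰(o) = B)·μ(|π(sel B)| ≤ 1)`, i.e. `μ(N = 1) ≤ E[max_{c ∈ π⁰(o)} μ(c ↮ A∖c); o ↔ A]`.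
[cite: KozmaNitzan2024, Lemma 1(i), Lemma 2 (pp. 5–6); this work] -/
theorem patternLightest_levelOne (w : Sym2 (Fin n) → unitInterval) (A : Finset (Fin n)) (o : Fin n) :
    ∃ sel : Finset (Fin n) → Fin n, (∀ B ∈ A.powerset.erase ∅, sel B ∈ B) ∧
      (prodBernoulli w).real {ω : BondConfig (Fin n) |
          1 ≤ (A.filter fun x => ω ∈ openConn o x).card ∧ (A.filter fun x => ω ∈ openConn o x).card ≤ 1} ≤
        ∑ B ∈ A.powerset.erase ∅,
          (prodBernoulli w).real {ω : BondConfig (Fin n) |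
              (A.filter fun b => ω ∈ openConnIn ((↑A : Set (Fin n))ᶜ ∪ {b}) o b) = B} *
            (prodBernoulli w).real
              {ω : BondConfig (Fin n) | (A.filter fun x => ω ∈ openConn (sel B) x).card ≤ 1} := by
  set μ := prodBernoulli w with hμ
  set D : Fin n → Set (BondConfig (Fin n)) := fun b => {ω | ∀ a ∈ A \ {b}, ω ∉ openConn b a} with hD
  set q : Fin n → ℝ := fun b => μ.real (D b) with hqdef
  set O : Fin n → Set (BondConfig (Fin n)) := fun b => openConnIn ((↑A : Set (Fin n))ᶜ ∪ {b}) o b with hO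
  obtain ⟨ρ, hρ, hmono⟩ := CoinReduction.exists_compatible_ranking q A
  set sel : Finset (Fin n) → Fin n := fun B =>
    if h : B.Nonempty then Classical.choose (Finset.exists_min_image B ρ h) else o with hseldef
  have hsel : ∀ B : Finset (Fin n), B.Nonempty → sel B ∈ B ∧ ∀ b ∈ B, ρ (sel B) ≤ ρ b := by
    intro B hB
    have hspec := Classical.choose_spec (Finset.exists_min_image B ρ hB)
    simp only [hseldef, dif_pos hB]
    exact ⟨hspec.1, hspec.2⟩
  have hselmem : ∀ B ∈ A.powerset.erase ∅, sel B ∈ B := fun B hB =>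
    (hsel B (Finset.nonempty_iff_ne_empty.2 (Finset.ne_of_mem_erase hB))).1
  refine ⟨sel, hselmem, ?_⟩
  -- (1) cover `{N = 1}` by `{o ↔ c} ∩ D_c`
  have hcover : {ω : BondConfig (Fin n) |
        1 ≤ (A.filter fun x => ω ∈ openConn o x).card ∧ (A.filter fun x => ω ∈ openConn o x).card ≤ 1} ⊆
      ⋃ c ∈ A, (openConn o c ∩ D c) := by
    intro ω hω
    obtain ⟨h1, h2⟩ := hω
    have hcard : (A.filter fun x => ω ∈ openConn o x).card = 1 := le_antisymm h2 h1
    obtain ⟨c, hc⟩ := Finset.card_eq_one.1 hcard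
    have hcf : c ∈ A.filter fun x => ω ∈ openConn o x := by rw [hc]; exact Finset.mem_singleton_self c
    obtain ⟨hcA, hoc⟩ := Finset.mem_filter.1 hcf
    refine mem_iUnion₂.2 ⟨c, hcA, hoc, fun a ha hca => ?_⟩
    obtain ⟨haA, hac⟩ := Finset.mem_sdiff.1 ha
    have hoa : ω ∈ openConn o a := (hoc : (openGraph ω).Reachable o c).trans hca
    have : a ∈ A.filter fun x => ω ∈ openConn o x := Finset.mem_filter.2 ⟨haA, hoa⟩
    rw [hc] at this
    exact hac this
  have hstep1 : μ.real {ω : BondConfig (Fin n) |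
        1 ≤ (A.filter fun x => ω ∈ openConn o x).card ∧ (A.filter fun x => ω ∈ openConn o x).card ≤ 1} ≤
      ∑ c ∈ A, μ.real (openConn o c ∩ D c) :=
    (measureReal_mono hcover (measure_ne_top μ _)).trans (measureReal_biUnion_finset_le _ _)
  -- (2) the engine with the directly-attached events
  have hstep2 := firstReached_isolation_le_events w A A o (subset_refl A) O
    (fun c _ => isUpperSet_openConnIn _ o c) (fun c _ ω h => by
      obtain ⟨hx, hy, hr⟩ := h
      exact hr.map (SimpleGraph.Embedding.induce _).toHom)
    (fun c _ ω h hiso => openConnIn_of_openConn_of_isolated A o c ω h hiso) ρ hρ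
    (fun b hb c hc h => hmono c hc b hb h)
  -- (3) selection sum = pattern sum (prim-hp-8's identity for the attachment pattern)
  have hE : ∀ b ∈ A, (O b ∩ {ω : BondConfig (Fin n) | ∀ c ∈ A, ρ c < ρ b → ω ∉ O c}) =
      {ω : BondConfig (Fin n) |
        b ∈ (A.filter fun b' => ω ∈ openConnIn ((↑A : Set (Fin n))ᶜ ∪ {b'}) o b') ∧
        ∀ b' ∈ A, ρ b' < ρ b → b' ∉ (A.filter fun b'' => ω ∈ openConnIn ((↑A : Set (Fin n))ᶜ ∪ {b''}) o b'')} := by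
    intro b hb
    ext ω
    simp only [hO, mem_inter_iff, mem_setOf_eq, Finset.mem_filter]
    constructor
    · rintro ⟨hob, h⟩
      exact ⟨⟨hb, hob⟩, fun b' hb' hlt hm => h b' hb' hlt hm.2⟩
    · rintro ⟨⟨_, hob⟩, h⟩
      exact ⟨hob, fun c hc hlt hoc => h c hc hlt ⟨hc, hoc⟩⟩
  have hstep3 := CoinReduction.sum_sel_eq_sum_patterns μ A o ρ hρ sel hsel q
  have hstep3' : ∑ b ∈ A, μ.real (O b ∩ {ω : BondConfig (Fin n) | ∀ c ∈ A, ρ c < ρ b → ω ∉ O c}) * q b =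
      ∑ B ∈ A.powerset.erase ∅, μ.real {ω : BondConfig (Fin n) |
        (A.filter fun b' => ω ∈ openConnIn ((↑A : Set (Fin n))ᶜ ∪ {b'}) o b') = B} * q (sel B) := by
    rw [← hstep3]
    exact Finset.sum_congr rfl fun b hb => by rw [hE b hb]
  have hstep4 : ∑ B ∈ A.powerset.erase ∅, μ.real {ω : BondConfig (Fin n) |
        (A.filter fun b' => ω ∈ openConnIn ((↑A : Set (Fin n))ᶜ ∪ {b'}) o b') = B} * q (sel B) =
      ∑ B ∈ A.powerset.erase ∅, μ.real {ω : BondConfig (Fin n) |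
        (A.filter fun b' => ω ∈ openConnIn ((↑A : Set (Fin n))ᶜ ∪ {b'}) o b') = B} *
        μ.real {ω : BondConfig (Fin n) | (A.filter fun x => ω ∈ openConn (sel B) x).card ≤ 1} := by
    refine Finset.sum_congr rfl fun B hB => ?_
    have hBA : B ⊆ A := Finset.mem_powerset.1 (Finset.mem_of_mem_erase hB)
    rw [light_one_eq_isolated A (sel B) (hBA (hselmem B hB))]
  calc μ.real {ω : BondConfig (Fin n) |
          1 ≤ (A.filter fun x => ω ∈ openConn o x).card ∧ (A.filter fun x => ω ∈ openConn o x).card ≤ 1}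
      ≤ ∑ c ∈ A, μ.real (openConn o c ∩ D c) := hstep1
    _ ≤ ∑ b ∈ A, μ.real (O b ∩ {ω : BondConfig (Fin n) | ∀ c ∈ A, ρ c < ρ b → ω ∉ O c}) * q b := hstep2
    _ = _ := hstep3'
    _ = _ := hstep4

end SelectionOrder

end Summit.CriticalPhenomena.PercolationContinuityZ3.Theorems

end
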